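import Summits.ValiantsHypothesis.ValiantsHypothesis.Theorems.LacunarySymmetroidMatrixDescartesCensusDoorA34NodeTypeLaw
import Summits.ValiantsHypothesis.ValiantsHypothesis.Theorems.LacunarySymmetroidMatrixDescartesCensusDoorA34NodeChambersComplex

/-!
# `MatrixDescartes` census — DOOR A at `(3,4)`: the conic TYPE of a nineteen in the complex-node classes R2 / R0

HONEST FRAMING.  Object-search cell `pub-symmetroid`, door-A seat `val-sym-door-p3` (g9); item stmt-ValiantsHypothesis-19980
`DoorA34 = PosRootLawAt 3 4 18` (route item `Theses.LacunarySymmetroid.DoorA34`) is OPEN and asserted nowhere in this file.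
Companion of `…NodeTypeLaw` (class R4: along a general-position nineteen the conic type `tr adj P(r)` is the parity of the node
sign vector) for the complex-node classes of `…NodeChambersComplex`.  For a pencil with letters
`S l = A 0 l • v₀v₀ᵀ + A 1 l • v₁v₁ᵀ + A 2 l • (rrᵀ − ssᵀ) − A 3 l • (rsᵀ + srᵀ)` (class R2; node nomials `ℓ₀, ℓ₁, m_R, m_I`) resp.
`S l = A 0 l • (ppᵀ − qqᵀ) − A 1 l • (pqᵀ + qpᵀ) + A 2 l • (rrᵀ − ssᵀ) − A 3 l • (rsᵀ + srᵀ)` (class R0) with NINETEEN positive det-roots: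

* `pencil_eval_R2`, `pencil_eval_R0` — the value at `t` is the R2 / R0 matrix with node values `∑ₗ A i l t^(d l)`;
* **`trace_adjugate_neg_of_R2_opposite_of_nineteen`** — at a root with `ℓ₀ℓ₁ < 0` (pair coefficient and `ℓ₀D₀²+ℓ₁D₁²` non-zero):
  `tr adj P(r) < 0` (real line pair; middle-eigenvalue crossing);
* **`trace_adjugate_pos_of_R2_pos_of_nineteen`** — at a root with `ℓ₀, ℓ₁ > 0` (same genericity): `tr adj P(r) > 0`;
* **`trace_adjugate_neg_of_R0_of_nineteen`** — class R0: at EVERY root (pair coefficients non-zero, test value non-zero) `tr adj P(r) < 0`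
  — an R0 nineteen would have all nineteen roots of indefinite type.

Nothing here bounds `ζ_sym(3,4)`; `DoorA34` stays OPEN; nothing bears on `MatrixDescartes` (stmt-ValiantsHypothesis-18050) or on
`VP ≠ VNP`.  [folklore] Bookkeeping over the two cited files.
-/

-- `Summit.ValiantsHypothesis.ValiantsHypothesis.…` repeats a component by the D-0017 layout
-- (single-conjunct summit), which the `dupNamespace` linter flags; the name is mandated.
set_option linter.dupNamespace false

namespace Summit.ValiantsHypothesis.ValiantsHypothesis.Theorems.LacunarySymmetroidMatrixDescartes.Census

open Finset Polynomial
open scoped BigOperators Matrix Polynomial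
open Summit.ValiantsHypothesis.ValiantsHypothesis.Theorems.SymmetroidDescartes (eval_det_pencil)

/-! ## Regrouping the R2 / R0 pencils by nodes -/

/-- The R2 pencil evaluated at `t` is the R2 matrix with node values `ℓᵢ(t) = ∑ₗ A i l t^(d l)`. [folklore] -/
theorem pencil_eval_R2 {K : ℕ} (d : Fin K → ℕ) (A : Fin 4 → Fin K → ℝ) (v₀ v₁ r s : Fin 3 → ℝ) (t : ℝ) :
    (∑ l, t ^ d l • (A 0 l • Matrix.vecMulVec v₀ v₀ + A 1 l • Matrix.vecMulVec v₁ v₁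
        + A 2 l • (Matrix.vecMulVec r r - Matrix.vecMulVec s s) - A 3 l • (Matrix.vecMulVec r s + Matrix.vecMulVec s r)))
      = (∑ l, A 0 l * t ^ d l) • Matrix.vecMulVec v₀ v₀ + (∑ l, A 1 l * t ^ d l) • Matrix.vecMulVec v₁ v₁
          + (∑ l, A 2 l * t ^ d l) • (Matrix.vecMulVec r r - Matrix.vecMulVec s s)
          - (∑ l, A 3 l * t ^ d l) • (Matrix.vecMulVec r s + Matrix.vecMulVec s r) := by
  ext a b
  simp only [Matrix.sum_apply, Matrix.smul_apply, Matrix.add_apply, Matrix.sub_apply, Matrix.vecMulVec_apply, smul_eq_mul,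
    Finset.sum_mul, ← Finset.sum_add_distrib, ← Finset.sum_sub_distrib]
  exact Finset.sum_congr rfl fun l _ => by ring

/-- The R0 pencil evaluated at `t` is the R0 matrix with node values `∑ₗ A i l t^(d l)`. [folklore] -/
theorem pencil_eval_R0 {K : ℕ} (d : Fin K → ℕ) (A : Fin 4 → Fin K → ℝ) (p q r s : Fin 3 → ℝ) (t : ℝ) :
    (∑ l, t ^ d l • (A 0 l • (Matrix.vecMulVec p p - Matrix.vecMulVec q q) - A 1 l • (Matrix.vecMulVec p q + Matrix.vecMulVec q p)
        + A 2 l • (Matrix.vecMulVec r r - Matrix.vecMulVec s s) - A 3 l • (Matrix.vecMulVec r s + Matrix.vecMulVec s r)))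
      = (∑ l, A 0 l * t ^ d l) • (Matrix.vecMulVec p p - Matrix.vecMulVec q q)
          - (∑ l, A 1 l * t ^ d l) • (Matrix.vecMulVec p q + Matrix.vecMulVec q p)
          + (∑ l, A 2 l * t ^ d l) • (Matrix.vecMulVec r r - Matrix.vecMulVec s s)
          - (∑ l, A 3 l * t ^ d l) • (Matrix.vecMulVec r s + Matrix.vecMulVec s r) := by
  ext a b
  simp only [Matrix.sum_apply, Matrix.smul_apply, Matrix.add_apply, Matrix.sub_apply, Matrix.vecMulVec_apply, smul_eq_mul,
    Finset.sum_mul, ← Finset.sum_add_distrib, ← Finset.sum_sub_distrib]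
  exact Finset.sum_congr rfl fun l _ => by ring

/-- The R2 letters are symmetric. [folklore] -/
theorem isSymm_letter_R2 {K : ℕ} (A : Fin 4 → Fin K → ℝ) (v₀ v₁ r s : Fin 3 → ℝ) (l : Fin K) :
    (A 0 l • Matrix.vecMulVec v₀ v₀ + A 1 l • Matrix.vecMulVec v₁ v₁
        + A 2 l • (Matrix.vecMulVec r r - Matrix.vecMulVec s s) - A 3 l • (Matrix.vecMulVec r s + Matrix.vecMulVec s r)).IsSymm := by
  have h := isHermitian_R2 v₀ v₁ r s (A 0 l) (A 1 l) (A 2 l) (A 3 l)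
  simpa [Matrix.isHermitian_iff_isSymm] using h

/-- The R0 letters are symmetric. [folklore] -/
theorem isSymm_letter_R0 {K : ℕ} (A : Fin 4 → Fin K → ℝ) (p q r s : Fin 3 → ℝ) (l : Fin K) :
    (A 0 l • (Matrix.vecMulVec p p - Matrix.vecMulVec q q) - A 1 l • (Matrix.vecMulVec p q + Matrix.vecMulVec q p)
        + A 2 l • (Matrix.vecMulVec r r - Matrix.vecMulVec s s) - A 3 l • (Matrix.vecMulVec r s + Matrix.vecMulVec s r)).IsSymm := by
  refine Matrix.IsSymm.ext fun a b => ?_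
  simp only [Matrix.add_apply, Matrix.sub_apply, Matrix.smul_apply, Matrix.vecMulVec_apply, smul_eq_mul]
  ring

/-! ## Class R2 -/

/-- **R2 nineteen, opposite real nodes ⇒ `tr adj < 0`** (indefinite conic type; a middle-eigenvalue crossing). [folklore] -/
theorem trace_adjugate_neg_of_R2_opposite_of_nineteen {d : Fin 4 → ℕ} (A : Fin 4 → Fin 4 → ℝ) (v₀ v₁ r s : Fin 3 → ℝ)
    (h19 : 19 ≤ ((Matrix.det (∑ l, ((X : ℝ[X]) ^ d l) • (A 0 l • Matrix.vecMulVec v₀ v₀ + A 1 l • Matrix.vecMulVec v₁ v₁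
        + A 2 l • (Matrix.vecMulVec r r - Matrix.vecMulVec s s)
        - A 3 l • (Matrix.vecMulVec r s + Matrix.vecMulVec s r)).map C)).roots.toFinset.filter (fun t => 0 < t)).card)
    {t : ℝ} (ht0 : 0 < t)
    (ht : (Matrix.det (∑ l, ((X : ℝ[X]) ^ d l) • (A 0 l • Matrix.vecMulVec v₀ v₀ + A 1 l • Matrix.vecMulVec v₁ v₁
        + A 2 l • (Matrix.vecMulVec r r - Matrix.vecMulVec s s)
        - A 3 l • (Matrix.vecMulVec r s + Matrix.vecMulVec s r)).map C)).IsRoot t)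
    (hℓ : (∑ l, A 0 l * t ^ d l) * (∑ l, A 1 l * t ^ d l) < 0)
    (hm : 0 < (∑ l, A 2 l * t ^ d l) ^ 2 + (∑ l, A 3 l * t ^ d l) ^ 2)
    (hz : (∑ l, A 0 l * t ^ d l) * (v₀ 0 * (r 1 * s 2 - r 2 * s 1) - v₀ 1 * (r 0 * s 2 - r 2 * s 0)
        + v₀ 2 * (r 0 * s 1 - r 1 * s 0)) ^ 2
        + (∑ l, A 1 l * t ^ d l) * (v₁ 0 * (r 1 * s 2 - r 2 * s 1) - v₁ 1 * (r 0 * s 2 - r 2 * s 0)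
        + v₁ 2 * (r 0 * s 1 - r 1 * s 0)) ^ 2 ≠ 0) :
    (∑ l, t ^ d l • (A 0 l • Matrix.vecMulVec v₀ v₀ + A 1 l • Matrix.vecMulVec v₁ v₁
        + A 2 l • (Matrix.vecMulVec r r - Matrix.vecMulVec s s)
        - A 3 l • (Matrix.vecMulVec r s + Matrix.vecMulVec s r))).adjugate.trace < 0 := by
  refine trace_adjugate_neg_of_not_posSemidef_of_nineteen d _ (isSymm_letter_R2 A v₀ v₁ r s) h19 ht0 ht ?_
  have hdet : ((∑ l, A 0 l * t ^ d l) • Matrix.vecMulVec v₀ v₀ + (∑ l, A 1 l * t ^ d l) • Matrix.vecMulVec v₁ v₁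
          + (∑ l, A 2 l * t ^ d l) • (Matrix.vecMulVec r r - Matrix.vecMulVec s s)
          - (∑ l, A 3 l * t ^ d l) • (Matrix.vecMulVec r s + Matrix.vecMulVec s r)).det = 0 := by
    rw [← pencil_eval_R2, ← eval_det_pencil]; exact ht
  rw [pencil_eval_R2]
  exact (indefinite_R2_of_opposite_realNodes v₀ v₁ r s _ _ _ _ hℓ hm hz hdet).2

/-- **R2 nineteen, two positive real nodes ⇒ `tr adj > 0`** (semidefinite conic type; a `λ_min` crossing). [folklore] -/
theorem trace_adjugate_pos_of_R2_pos_of_nineteen {d : Fin 4 → ℕ} (A : Fin 4 → Fin 4 → ℝ) (v₀ v₁ r s : Fin 3 → ℝ)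
    (h19 : 19 ≤ ((Matrix.det (∑ l, ((X : ℝ[X]) ^ d l) • (A 0 l • Matrix.vecMulVec v₀ v₀ + A 1 l • Matrix.vecMulVec v₁ v₁
        + A 2 l • (Matrix.vecMulVec r r - Matrix.vecMulVec s s)
        - A 3 l • (Matrix.vecMulVec r s + Matrix.vecMulVec s r)).map C)).roots.toFinset.filter (fun t => 0 < t)).card)
    {t : ℝ} (ht0 : 0 < t)
    (ht : (Matrix.det (∑ l, ((X : ℝ[X]) ^ d l) • (A 0 l • Matrix.vecMulVec v₀ v₀ + A 1 l • Matrix.vecMulVec v₁ v₁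
        + A 2 l • (Matrix.vecMulVec r r - Matrix.vecMulVec s s)
        - A 3 l • (Matrix.vecMulVec r s + Matrix.vecMulVec s r)).map C)).IsRoot t)
    (h0 : 0 < ∑ l, A 0 l * t ^ d l) (h1 : 0 < ∑ l, A 1 l * t ^ d l)
    (hm : 0 < (∑ l, A 2 l * t ^ d l) ^ 2 + (∑ l, A 3 l * t ^ d l) ^ 2)
    (hz : 0 < (∑ l, A 0 l * t ^ d l) * (v₀ 0 * (r 1 * s 2 - r 2 * s 1) - v₀ 1 * (r 0 * s 2 - r 2 * s 0)
        + v₀ 2 * (r 0 * s 1 - r 1 * s 0)) ^ 2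
        + (∑ l, A 1 l * t ^ d l) * (v₁ 0 * (r 1 * s 2 - r 2 * s 1) - v₁ 1 * (r 0 * s 2 - r 2 * s 0)
        + v₁ 2 * (r 0 * s 1 - r 1 * s 0)) ^ 2) :
    0 < (∑ l, t ^ d l • (A 0 l • Matrix.vecMulVec v₀ v₀ + A 1 l • Matrix.vecMulVec v₁ v₁
        + A 2 l • (Matrix.vecMulVec r r - Matrix.vecMulVec s s)
        - A 3 l • (Matrix.vecMulVec r s + Matrix.vecMulVec s r))).adjugate.trace := by
  refine trace_adjugate_pos_of_posSemidef_of_nineteen d _ (isSymm_letter_R2 A v₀ v₁ r s) h19 ht0 ht ?_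
  have hdet : ((∑ l, A 0 l * t ^ d l) • Matrix.vecMulVec v₀ v₀ + (∑ l, A 1 l * t ^ d l) • Matrix.vecMulVec v₁ v₁
          + (∑ l, A 2 l * t ^ d l) • (Matrix.vecMulVec r r - Matrix.vecMulVec s s)
          - (∑ l, A 3 l * t ^ d l) • (Matrix.vecMulVec r s + Matrix.vecMulVec s r)).det = 0 := by
    rw [← pencil_eval_R2, ← eval_det_pencil]; exact ht
  rw [pencil_eval_R2]
  exact posSemidef_R2_of_pos_realNodes v₀ v₁ r s _ _ _ _ h0 h1 hm hz hdet

/-! ## Class R0 -/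

/-- **R0 nineteen ⇒ `tr adj < 0` at every root** (with the pair coefficients and the test value `Q(p × q)` non-zero there): in class
R0 all roots of a nineteen would be of indefinite type (middle-eigenvalue crossings). [folklore] -/
theorem trace_adjugate_neg_of_R0_of_nineteen {d : Fin 4 → ℕ} (A : Fin 4 → Fin 4 → ℝ) (p q r s : Fin 3 → ℝ)
    (h19 : 19 ≤ ((Matrix.det (∑ l, ((X : ℝ[X]) ^ d l) • (A 0 l • (Matrix.vecMulVec p p - Matrix.vecMulVec q q)
        - A 1 l • (Matrix.vecMulVec p q + Matrix.vecMulVec q p) + A 2 l • (Matrix.vecMulVec r r - Matrix.vecMulVec s s)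
        - A 3 l • (Matrix.vecMulVec r s + Matrix.vecMulVec s r)).map C)).roots.toFinset.filter (fun t => 0 < t)).card)
    {t : ℝ} (ht0 : 0 < t)
    (ht : (Matrix.det (∑ l, ((X : ℝ[X]) ^ d l) • (A 0 l • (Matrix.vecMulVec p p - Matrix.vecMulVec q q)
        - A 1 l • (Matrix.vecMulVec p q + Matrix.vecMulVec q p) + A 2 l • (Matrix.vecMulVec r r - Matrix.vecMulVec s s)
        - A 3 l • (Matrix.vecMulVec r s + Matrix.vecMulVec s r)).map C)).IsRoot t)
    (hl : 0 < (∑ l, A 0 l * t ^ d l) ^ 2 + (∑ l, A 1 l * t ^ d l) ^ 2)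
    (hm : 0 < (∑ l, A 2 l * t ^ d l) ^ 2 + (∑ l, A 3 l * t ^ d l) ^ 2)
    (hz₁ : (∑ l, A 2 l * t ^ d l) * ((p 0 * (q 1 * r 2 - q 2 * r 1) - p 1 * (q 0 * r 2 - q 2 * r 0) + p 2 * (q 0 * r 1 - q 1 * r 0)) ^ 2
          - (p 0 * (q 1 * s 2 - q 2 * s 1) - p 1 * (q 0 * s 2 - q 2 * s 0) + p 2 * (q 0 * s 1 - q 1 * s 0)) ^ 2)
        - 2 * (∑ l, A 3 l * t ^ d l) * ((p 0 * (q 1 * r 2 - q 2 * r 1) - p 1 * (q 0 * r 2 - q 2 * r 0) + p 2 * (q 0 * r 1 - q 1 * r 0))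
          * (p 0 * (q 1 * s 2 - q 2 * s 1) - p 1 * (q 0 * s 2 - q 2 * s 0) + p 2 * (q 0 * s 1 - q 1 * s 0))) ≠ 0) :
    (∑ l, t ^ d l • (A 0 l • (Matrix.vecMulVec p p - Matrix.vecMulVec q q) - A 1 l • (Matrix.vecMulVec p q + Matrix.vecMulVec q p)
        + A 2 l • (Matrix.vecMulVec r r - Matrix.vecMulVec s s)
        - A 3 l • (Matrix.vecMulVec r s + Matrix.vecMulVec s r))).adjugate.trace < 0 := by
  refine trace_adjugate_neg_of_not_posSemidef_of_nineteen d _ (isSymm_letter_R0 A p q r s) h19 ht0 ht ?_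
  have hdet : ((∑ l, A 0 l * t ^ d l) • (Matrix.vecMulVec p p - Matrix.vecMulVec q q)
          - (∑ l, A 1 l * t ^ d l) • (Matrix.vecMulVec p q + Matrix.vecMulVec q p)
          + (∑ l, A 2 l * t ^ d l) • (Matrix.vecMulVec r r - Matrix.vecMulVec s s)
          - (∑ l, A 3 l * t ^ d l) • (Matrix.vecMulVec r s + Matrix.vecMulVec s r)).det = 0 := by
    rw [← pencil_eval_R0, ← eval_det_pencil]; exact ht
  rw [pencil_eval_R0]
  exact (indefinite_R0 p q r s _ _ _ _ hl hm hz₁ hdet).2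

end Summit.ValiantsHypothesis.ValiantsHypothesis.Theorems.LacunarySymmetroidMatrixDescartes.Census
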